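import Literature.Combinatorics.Sahi2008.Functional
import Mathlib.Tactic.Ring
import Mathlib.Tactic.Linarith
import Mathlib.Tactic.Positivity
import Mathlib.Tactic.LinearCombination
import HarnessLib

/-!
# The fresh-coin lemma holds at ORDER 3 for EVERY law and every slot pattern

Support file for the Sahi / hitting-event programme (seat `prim-l12-p5`, gen 15; `--supports stmt-CriticalPhenomena-4575`).
No definitions, no named facts, no sorries; standard axioms.  Memo
`run/shared/lean/prim/prim-l12/FROM-prim-l12-p5-g15-FCL-ORDER3-AND-FLOW-REDUCTION.md` §2.

CONTEXT.  The "fresh-coin / push-up lemma" FCL (hypothesis `hFCL` of `…SahiHittingFreshCoin`: OR-ing one independent event `C` onto a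
sub-family preserves Sahi positivity at every order) is FALSE for abstract laws from order 4 on (census `ttrl/coin/COIN.md` §9–9.2,
exact witnesses at `(order, #slots) = (4,2), (5,3)`).  This file proves it at ORDER 3 for EVERY law, with exact identities; the first-order
term of a two-slot push-up is a functional of the MERGED family `(E₁ ∩ E₂, E₃)`, controlled at order 3 by `E₃ ≥ 0` alone (`twoSlot_atoms`).

SETTING.  A finite type `α` with a weight `μ` (`ex μ f = Σ μ(x) f(x)`; `sahiE μ n` = Sahi's functional [Sahi2008, (4)–(7)]);
`{0,1}`-valued `a b d : α → ℝ` (indicators of three events; repetitions allowed) and `c : α → ℝ` (indicator of the coin `C`) with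
`E(c·g) = E(c)·E(g)` for every product `g` of a sub-family ("`C` independent of the family"; the shape of `hFCL`'s premise).  The OR of
indicators is `a ⊔ c = a + c − a·c`; `p = E(c)`.

RESULTS (all `[this work]`): `sahiE3_or_slot0` (ONE slot: `E₃(a⊔c,b,d) = (1−p)E₃ + p·E₂(b,d)`), `sahiE3_or_slots01` (TWO slots:
`E₃(a⊔c,b⊔c,d) = (1−p)²E₃ + p(1−p)F`, `F = E(abd) − E(ab)E(d) + E(āb̄d)`), `twoSlot_atoms`/`F_nonneg_of_sahiE3_nonneg` (NEW LEMMA: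
`E a ≥ E b ⇒ (2 − E a)F ≥ E₃`, so `E₃ ≥ 0 ⇒ F ≥ 0`), `sahiE3_or_slots012` (THREE slots: gen 14's identity), and the nonnegativity
theorems `sahiE3_freshCoin_nonneg_slot0/slots01/slots012` (other slot patterns by the symmetry of `E₃`, `sahiE_comp_perm`): FCL holds at
order 3 for every law.  Companion file `…SahiFreshCoinOrderFourAllSlots`: order 4, all four slots, `E₄(pushed) ≥ (1−p)²E₄`.
-/

namespace Summit.CriticalPhenomena.PercolationContinuityZ3.Theorems

namespace SahiFreshCoinOrderThree

open Finset Literature.Combinatorics.Sahi2008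

/-- A `{0,1}`-valued function takes values in `[0,1]`. [folklore] -/
theorem zeroOne_bounds {α : Type*} {f : α → ℝ} (hf : ∀ x, f x = 0 ∨ f x = 1) (x : α) : 0 ≤ f x ∧ f x ≤ 1 := by
  rcases hf x with h | h <;> rw [h] <;> norm_num

/-- A `{0,1}`-valued function is idempotent. [folklore] -/
theorem zeroOne_mul_self {α : Type*} {f : α → ℝ} (hf : ∀ x, f x = 0 ∨ f x = 1) (x : α) : f x * f x = f x := by
  rcases hf x with h | h <;> rw [h] <;> norm_num

variable {α : Type*} [Fintype α]

/-! ### Bookkeeping for `ex` -/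
/-- `E(f − g) = E f − E g`. [folklore] -/
theorem ex_sub (μ f g : α → ℝ) : ex μ (f - g) = ex μ f - ex μ g := by
  simp only [ex_def, Pi.sub_apply, mul_sub, sum_sub_distrib]

/-! ### Unpacking the independence hypothesis (products over sub-families of three slots) -/
/-- The seven relations `E(c·g) = E(c)E(g)` (`g` a sub-family product) from the `Finset (Fin 3)`-quantified hypothesis. [this work] -/
theorem indep_unpack3 (μ : α → ℝ) (a b d c : α → ℝ)
    (hind : ∀ s : Finset (Fin 3), ex μ (c * ∏ i ∈ s, ![a, b, d] i) = ex μ c * ex μ (∏ i ∈ s, ![a, b, d] i)) :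
    ex μ (c * a) = ex μ c * ex μ a ∧ ex μ (c * b) = ex μ c * ex μ b ∧ ex μ (c * d) = ex μ c * ex μ d ∧
      ex μ (c * (a * b)) = ex μ c * ex μ (a * b) ∧ ex μ (c * (a * d)) = ex μ c * ex μ (a * d) ∧
      ex μ (c * (b * d)) = ex μ c * ex μ (b * d) ∧ ex μ (c * (a * b * d)) = ex μ c * ex μ (a * b * d) := by
  have f0 : (![a, b, d] : Fin 3 → α → ℝ) 0 = a := rfl
  have f1 : (![a, b, d] : Fin 3 → α → ℝ) 1 = b := rfl
  have f2 : (![a, b, d] : Fin 3 → α → ℝ) 2 = d := rfl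
  have ha := hind {0}
  have hb := hind {1}
  have hd := hind {2}
  have hab := hind {0, 1}
  have had := hind {0, 2}
  have hbd := hind {1, 2}
  have habd := hind {0, 1, 2}
  rw [prod_singleton] at ha hb hd
  rw [prod_pair (by decide)] at hab had hbd
  rw [prod_insert (by decide), prod_pair (by decide)] at habd
  rw [f0] at ha; rw [f1] at hb; rw [f2] at hd
  rw [f0, f1] at hab; rw [f0, f2] at had; rw [f1, f2] at hbd
  have hassoc : a * (b * d) = a * b * d := (mul_assoc a b d).symm
  rw [f0, f1, f2, hassoc] at habd
  exact ⟨ha, hb, hd, hab, had, hbd, habd⟩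

/-! ### ONE slot: `E₃(a ⊔ c, b, d) = (1−p)E₃ + p·E₂(b,d)` -/
/-- **One slot.**  For ANY real functions `a,b,d` and `c` with `E(c·g) = E(c)E(g)` on the sub-family products:
`E₃(a + c − ac, b, d) = (1 − E c)·E₃(a,b,d) + E c · E₂(b,d)`. [this work] -/
theorem sahiE3_or_slot0 (μ : α → ℝ) (a b d c : α → ℝ)
    (hind : ∀ s : Finset (Fin 3), ex μ (c * ∏ i ∈ s, ![a, b, d] i) = ex μ c * ex μ (∏ i ∈ s, ![a, b, d] i)) :
    sahiE μ 3 ![a + c - a * c, b, d] = (1 - ex μ c) * sahiE μ 3 ![a, b, d] + ex μ c * sahiE μ 2 ![b, d] := by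
  obtain ⟨ha, hb, hd, hab, had, hbd, habd⟩ := indep_unpack3 μ a b d c hind
  rw [sahiE_three, sahiE_three, sahiE_two]
  have e1 : ex μ (a + c - a * c) = ex μ a + ex μ c - ex μ c * ex μ a := by
    have : a + c - a * c = a + c - c * a := by funext x; simp only [Pi.mul_apply, Pi.add_apply, Pi.sub_apply]; ring
    rw [this, ex_sub, ex_add, ha]
  have e2 : ex μ ((a + c - a * c) * b * d) =
      ex μ (a * b * d) + ex μ c * ex μ (b * d) - ex μ c * ex μ (a * b * d) := by
    have : (a + c - a * c) * b * d = a * b * d + c * (b * d) - c * (a * b * d) := by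
      funext x; simp only [Pi.mul_apply, Pi.add_apply, Pi.sub_apply]; ring
    rw [this, ex_sub, ex_add, hbd, habd]
  have e3 : ex μ ((a + c - a * c) * d) = ex μ (a * d) + ex μ c * ex μ d - ex μ c * ex μ (a * d) := by
    have : (a + c - a * c) * d = a * d + c * d - c * (a * d) := by
      funext x; simp only [Pi.mul_apply, Pi.add_apply, Pi.sub_apply]; ring
    rw [this, ex_sub, ex_add, hd, had]
  have e4 : ex μ ((a + c - a * c) * b) = ex μ (a * b) + ex μ c * ex μ b - ex μ c * ex μ (a * b) := by
    have : (a + c - a * c) * b = a * b + c * b - c * (a * b) := by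
      funext x; simp only [Pi.mul_apply, Pi.add_apply, Pi.sub_apply]; ring
    rw [this, ex_sub, ex_add, hb, hab]
  rw [e1, e2, e3, e4]
  ring

/-! ### TWO slots: `E₃(a ⊔ c, b ⊔ c, d) = (1−p)²E₃ + p(1−p)F` -/
/-- **Two slots.**  For real `a,b,d` and an idempotent independent `c` (`p = E c`):
`E₃(a⊔c, b⊔c, d) = (1−p)²E₃(a,b,d) + p(1−p)·[E(abd) − E(ab)E(d) + E((1−a)(1−b)d)]`. [this work] -/
theorem sahiE3_or_slots01 (μ : α → ℝ) (a b d c : α → ℝ) (hc : ∀ x, c x * c x = c x)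
    (hind : ∀ s : Finset (Fin 3), ex μ (c * ∏ i ∈ s, ![a, b, d] i) = ex μ c * ex μ (∏ i ∈ s, ![a, b, d] i)) :
    sahiE μ 3 ![a + c - a * c, b + c - b * c, d] =
      (1 - ex μ c) ^ 2 * sahiE μ 3 ![a, b, d] +
        ex μ c * (1 - ex μ c) *
          (ex μ (a * b * d) - ex μ (a * b) * ex μ d + ex μ ((1 - a) * (1 - b) * d)) := by
  obtain ⟨ha, hb, hd, hab, had, hbd, habd⟩ := indep_unpack3 μ a b d c hind
  rw [sahiE_three, sahiE_three]
  have e1 : ex μ (a + c - a * c) = ex μ a + ex μ c - ex μ c * ex μ a := by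
    have : a + c - a * c = a + c - c * a := by funext x; simp only [Pi.mul_apply, Pi.add_apply, Pi.sub_apply]; ring
    rw [this, ex_sub, ex_add, ha]
  have e1' : ex μ (b + c - b * c) = ex μ b + ex μ c - ex μ c * ex μ b := by
    have : b + c - b * c = b + c - c * b := by funext x; simp only [Pi.mul_apply, Pi.add_apply, Pi.sub_apply]; ring
    rw [this, ex_sub, ex_add, hb]
  have e2 : ex μ ((a + c - a * c) * (b + c - b * c) * d) =
      ex μ (a * b * d) + ex μ c * ex μ d - ex μ c * ex μ (a * b * d) := by
    have : (a + c - a * c) * (b + c - b * c) * d = a * b * d + c * d - c * (a * b * d) := by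
      funext x; simp only [Pi.mul_apply, Pi.add_apply, Pi.sub_apply]
      linear_combination (1 - a x) * (1 - b x) * d x * hc x
    rw [this, ex_sub, ex_add, hd, habd]
  have e3 : ex μ ((a + c - a * c) * d) = ex μ (a * d) + ex μ c * ex μ d - ex μ c * ex μ (a * d) := by
    have : (a + c - a * c) * d = a * d + c * d - c * (a * d) := by
      funext x; simp only [Pi.mul_apply, Pi.add_apply, Pi.sub_apply]; ring
    rw [this, ex_sub, ex_add, hd, had]
  have e3' : ex μ ((b + c - b * c) * d) = ex μ (b * d) + ex μ c * ex μ d - ex μ c * ex μ (b * d) := by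
    have : (b + c - b * c) * d = b * d + c * d - c * (b * d) := by
      funext x; simp only [Pi.mul_apply, Pi.add_apply, Pi.sub_apply]; ring
    rw [this, ex_sub, ex_add, hd, hbd]
  have e4 : ex μ ((a + c - a * c) * (b + c - b * c)) = ex μ (a * b) + ex μ c - ex μ c * ex μ (a * b) := by
    have : (a + c - a * c) * (b + c - b * c) = a * b + c - c * (a * b) := by
      funext x; simp only [Pi.mul_apply, Pi.add_apply, Pi.sub_apply]
      linear_combination (1 - a x) * (1 - b x) * hc x
    rw [this, ex_sub, ex_add, hab]
  have e5 : ex μ ((1 - a) * (1 - b) * d) = ex μ d - ex μ (a * d) - ex μ (b * d) + ex μ (a * b * d) := by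
    have : (1 - a) * (1 - b) * d = d - a * d - b * d + a * b * d := by
      funext x; simp only [Pi.mul_apply, Pi.add_apply, Pi.sub_apply, Pi.one_apply]; ring
    rw [this, ex_add, ex_sub, ex_sub]
  rw [e1, e1', e2, e3, e3', e4, e5]
  ring

/-! ### The two-slot core lemma: `E₃ ≥ 0 ⇒ F ≥ 0` -/
/-- **Atom certificate.**  Venn atoms `e` (none), `d1`,`d2` (only `a` / only `b`), `ap` (`ab¬d`), `bb` (only `d`), `c1` (`a¬bd`),
`c2` (`¬abd`), `aa` (`abd`) ≥ 0 summing to 1 with `E a ≥ E b`: `(2 − E a)F − E₃ = N + ap·c2·((d1+c1)−(d2+c2))`, `N ⪰ 0`. [this work] -/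
theorem twoSlot_atoms (e d1 d2 ap bb c1 c2 aa : ℝ) (he : 0 ≤ e) (hd1 : 0 ≤ d1) (hd2 : 0 ≤ d2) (hap : 0 ≤ ap)
    (hbb : 0 ≤ bb) (hc1 : 0 ≤ c1) (hc2 : 0 ≤ c2) (haa : 0 ≤ aa) (hsum : e + d1 + d2 + ap + bb + c1 + c2 + aa = 1)
    (hab : d2 + c2 ≤ d1 + c1) :
    2 * aa + (d1 + ap + c1 + aa) * (d2 + ap + c2 + aa) * (bb + c1 + c2 + aa)
        - ((d1 + ap + c1 + aa) * (c2 + aa) + (d2 + ap + c2 + aa) * (c1 + aa) + (bb + c1 + c2 + aa) * (ap + aa))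
      ≤ (2 - (d1 + ap + c1 + aa)) * (aa - (ap + aa) * (bb + c1 + c2 + aa) + bb) := by
  have he' : e = 1 - (d1 + d2 + ap + bb + c1 + c2 + aa) := by linarith
  have key : (2 - (d1 + ap + c1 + aa)) * (aa - (ap + aa) * (bb + c1 + c2 + aa) + bb)
      - (2 * aa + (d1 + ap + c1 + aa) * (d2 + ap + c2 + aa) * (bb + c1 + c2 + aa)
        - ((d1 + ap + c1 + aa) * (c2 + aa) + (d2 + ap + c2 + aa) * (c1 + aa) + (bb + c1 + c2 + aa) * (ap + aa))) =
      (e*d2*aa + d1*bb*aa + d1^2*bb + d2^2*aa + d1*ap*bb + d2*ap*bb + ap*bb*c1 + ap*bb*c2 + bb*c1*aa + bb*c1^2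
        + e*c2*aa + d1*c2*aa + d2*c2*aa + c1*c2*aa + e*d2*c1 + d2^2*c1 + c1^2*c2 + c1*c2^2 + e*d1*c2 + d1^2*c2
        + 2*(e*bb*aa) + 2*(e^2*bb) + 2*(d1*d2*bb) + 2*(d1*bb*c1) + 2*(d2*bb*aa) + 2*(d2^2*bb) + 2*(e*ap*bb) + 2*(ap*bb^2)
        + 2*(bb^2*aa) + 2*bb^3 + 2*(bb*c2*aa) + 2*(bb*c2^2) + 2*(d2*c1*c2) + 2*(e*c1*c2) + 2*(d1*c1*c2)
        + 3*(e*d1*bb) + 3*(e*bb*c1) + 3*(d1*bb^2) + 3*(d1*bb*c2) + 3*(d2*bb*c1) + 3*(bb^2*c1)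
        + 4*(e*d2*bb) + 4*(e*bb^2) + 4*(e*bb*c2) + 4*(d2*bb^2) + 4*(d2*bb*c2) + 4*(bb^2*c2) + 4*(bb*c1*c2))
      + ap * c2 * ((d1 + c1) - (d2 + c2)) := by
    rw [he']; ring
  have hN : 0 ≤ ap * c2 * ((d1 + c1) - (d2 + c2)) := mul_nonneg (mul_nonneg hap hc2) (by linarith)
  have hP : 0 ≤ e*d2*aa + d1*bb*aa + d1^2*bb + d2^2*aa + d1*ap*bb + d2*ap*bb + ap*bb*c1 + ap*bb*c2 + bb*c1*aa + bb*c1^2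
        + e*c2*aa + d1*c2*aa + d2*c2*aa + c1*c2*aa + e*d2*c1 + d2^2*c1 + c1^2*c2 + c1*c2^2 + e*d1*c2 + d1^2*c2
        + 2*(e*bb*aa) + 2*(e^2*bb) + 2*(d1*d2*bb) + 2*(d1*bb*c1) + 2*(d2*bb*aa) + 2*(d2^2*bb) + 2*(e*ap*bb) + 2*(ap*bb^2)
        + 2*(bb^2*aa) + 2*bb^3 + 2*(bb*c2*aa) + 2*(bb*c2^2) + 2*(d2*c1*c2) + 2*(e*c1*c2) + 2*(d1*c1*c2)
        + 3*(e*d1*bb) + 3*(e*bb*c1) + 3*(d1*bb^2) + 3*(d1*bb*c2) + 3*(d2*bb*c1) + 3*(bb^2*c1)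
        + 4*(e*d2*bb) + 4*(e*bb^2) + 4*(e*bb*c2) + 4*(d2*bb^2) + 4*(d2*bb*c2) + 4*(bb^2*c2) + 4*(bb*c1*c2) := by
    positivity
  linarith [key, hN, hP]

/-- **`E₃ ≥ 0 ⇒ F ≥ 0`** for a probability weight and `{0,1}`-valued `a,b,d`: `F = Cov(1_{A∩B},1_D) + μ(Aᶜ∩Bᶜ∩D) ≥ 0`;
in fact `E₃ ≤ (2 − max(E a, E b))·F`. [this work] -/
theorem F_nonneg_of_sahiE3_nonneg (μ : α → ℝ) (hμ : ∀ x, 0 ≤ μ x) (hμ1 : ∑ x, μ x = 1) (a b d : α → ℝ)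
    (ha : ∀ x, a x = 0 ∨ a x = 1) (hb : ∀ x, b x = 0 ∨ b x = 1) (hd : ∀ x, d x = 0 ∨ d x = 1)
    (hE3 : 0 ≤ sahiE μ 3 ![a, b, d]) :
    0 ≤ ex μ (a * b * d) - ex μ (a * b) * ex μ d + ex μ ((1 - a) * (1 - b) * d) := by
  -- the eight atoms
  set e := ex μ ((1 - a) * (1 - b) * (1 - d)) with he_def
  set d1 := ex μ (a * (1 - b) * (1 - d)) with hd1_def
  set d2 := ex μ ((1 - a) * b * (1 - d)) with hd2_def
  set ap := ex μ (a * b * (1 - d)) with hap_def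
  set bb := ex μ ((1 - a) * (1 - b) * d) with hbb_def
  set c1 := ex μ (a * (1 - b) * d) with hc1_def
  set c2 := ex μ ((1 - a) * b * d) with hc2_def
  set aa := ex μ (a * b * d) with haa_def
  have pa := fun x => (zeroOne_bounds ha x).1
  have pb := fun x => (zeroOne_bounds hb x).1
  have pd := fun x => (zeroOne_bounds hd x).1
  have qa : ∀ x, 0 ≤ (1 - a) x := fun x => by simp only [Pi.sub_apply, Pi.one_apply]; linarith [(zeroOne_bounds ha x).2]
  have qb : ∀ x, 0 ≤ (1 - b) x := fun x => by simp only [Pi.sub_apply, Pi.one_apply]; linarith [(zeroOne_bounds hb x).2]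
  have qd : ∀ x, 0 ≤ (1 - d) x := fun x => by simp only [Pi.sub_apply, Pi.one_apply]; linarith [(zeroOne_bounds hd x).2]
  -- nonnegativity of the atoms: each is `E` of a product of three pointwise-nonnegative functions
  have P3 : ∀ u v w : α → ℝ, (∀ x, 0 ≤ u x) → (∀ x, 0 ≤ v x) → (∀ x, 0 ≤ w x) → 0 ≤ ex μ (u * v * w) :=
    fun u v w hu hv hw => ex_nonneg hμ fun x => mul_nonneg (mul_nonneg (hu x) (hv x)) (hw x)
  have ge : 0 ≤ e := P3 _ _ _ qa qb qd
  have gd1 : 0 ≤ d1 := P3 _ _ _ pa qb qd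
  have gd2 : 0 ≤ d2 := P3 _ _ _ qa pb qd
  have gap : 0 ≤ ap := P3 _ _ _ pa pb qd
  have gbb : 0 ≤ bb := P3 _ _ _ qa qb pd
  have gc1 : 0 ≤ c1 := P3 _ _ _ pa qb pd
  have gc2 : 0 ≤ c2 := P3 _ _ _ qa pb pd
  have gaa : 0 ≤ aa := P3 _ _ _ pa pb pd
  -- moments in terms of atoms (pure linearity; no idempotence needed)
  have lin : ∀ f g : α → ℝ, (∀ x, f x = g x) → ex μ f = ex μ g := fun f g h => by
    simp only [ex_def]; exact sum_congr rfl fun x _ => by rw [h x]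
  have ma : ex μ a = d1 + ap + c1 + aa := by
    rw [hd1_def, hap_def, hc1_def, haa_def, ← ex_add, ← ex_add, ← ex_add]
    exact lin _ _ fun x => by simp only [Pi.mul_apply, Pi.add_apply, Pi.sub_apply, Pi.one_apply]; ring
  have mb : ex μ b = d2 + ap + c2 + aa := by
    rw [hd2_def, hap_def, hc2_def, haa_def, ← ex_add, ← ex_add, ← ex_add]
    exact lin _ _ fun x => by simp only [Pi.mul_apply, Pi.add_apply, Pi.sub_apply, Pi.one_apply]; ring
  have md : ex μ d = bb + c1 + c2 + aa := by
    rw [hbb_def, hc1_def, hc2_def, haa_def, ← ex_add, ← ex_add, ← ex_add]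
    exact lin _ _ fun x => by simp only [Pi.mul_apply, Pi.add_apply, Pi.sub_apply, Pi.one_apply]; ring
  have mab : ex μ (a * b) = ap + aa := by
    rw [hap_def, haa_def, ← ex_add]
    exact lin _ _ fun x => by simp only [Pi.mul_apply, Pi.add_apply, Pi.sub_apply, Pi.one_apply]; ring
  have mad : ex μ (a * d) = c1 + aa := by
    rw [hc1_def, haa_def, ← ex_add]
    exact lin _ _ fun x => by simp only [Pi.mul_apply, Pi.add_apply, Pi.sub_apply, Pi.one_apply]; ring
  have mbd : ex μ (b * d) = c2 + aa := by
    rw [hc2_def, haa_def, ← ex_add]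
    exact lin _ _ fun x => by simp only [Pi.mul_apply, Pi.add_apply, Pi.sub_apply, Pi.one_apply]; ring
  have hsum : e + d1 + d2 + ap + bb + c1 + c2 + aa = 1 := by
    rw [he_def, hd1_def, hd2_def, hap_def, hbb_def, hc1_def, hc2_def, haa_def, ← ex_add, ← ex_add, ← ex_add, ← ex_add,
      ← ex_add, ← ex_add, ← ex_add, ← ex_one hμ1]
    exact lin _ _ fun x => by simp only [Pi.mul_apply, Pi.add_apply, Pi.sub_apply, Pi.one_apply]; ring
  -- E₃ in atoms
  rw [sahiE_three, ma, mb, md, mab, mad, mbd] at hE3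
  rw [mab, md]
  -- case split on which of E(a), E(b) is larger
  rcases le_total (d2 + c2) (d1 + c1) with hle | hle
  · have key := twoSlot_atoms e d1 d2 ap bb c1 c2 aa ge gd1 gd2 gap gbb gc1 gc2 gaa hsum hle
    have h2 : 0 < 2 - (d1 + ap + c1 + aa) := by linarith
    by_contra hneg
    have hlt : aa - (ap + aa) * (bb + c1 + c2 + aa) + bb < 0 := lt_of_not_ge hneg
    have : (2 - (d1 + ap + c1 + aa)) * (aa - (ap + aa) * (bb + c1 + c2 + aa) + bb) < 0 := mul_neg_of_pos_of_neg h2 hlt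
    linarith
  · -- swap the roles of a and b (both E₃ and F are symmetric)
    have hsum' : e + d2 + d1 + ap + bb + c2 + c1 + aa = 1 := by linarith
    have key := twoSlot_atoms e d2 d1 ap bb c2 c1 aa ge gd2 gd1 gap gbb gc2 gc1 gaa hsum' hle
    have hE : 2 * aa + (d2 + ap + c2 + aa) * (d1 + ap + c1 + aa) * (bb + c2 + c1 + aa)
        - ((d2 + ap + c2 + aa) * (c1 + aa) + (d1 + ap + c1 + aa) * (c2 + aa) + (bb + c2 + c1 + aa) * (ap + aa)) =
        2 * aa + (d1 + ap + c1 + aa) * (d2 + ap + c2 + aa) * (bb + c1 + c2 + aa)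
        - ((d1 + ap + c1 + aa) * (c2 + aa) + (d2 + ap + c2 + aa) * (c1 + aa) + (bb + c1 + c2 + aa) * (ap + aa)) := by
      ring
    have hF : aa - (ap + aa) * (bb + c2 + c1 + aa) + bb = aa - (ap + aa) * (bb + c1 + c2 + aa) + bb := by ring
    rw [hE, hF] at key
    have h2 : 0 < 2 - (d2 + ap + c2 + aa) := by linarith
    by_contra hneg
    have hlt : aa - (ap + aa) * (bb + c1 + c2 + aa) + bb < 0 := lt_of_not_ge hneg
    have : (2 - (d2 + ap + c2 + aa)) * (aa - (ap + aa) * (bb + c1 + c2 + aa) + bb) < 0 := mul_neg_of_pos_of_neg h2 hlt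
    linarith

/-! ### Nonnegativity: one and two slots -/
/-- `p = E(c) ∈ [0,1]` for a `{0,1}`-valued `c` under a probability weight. [folklore] -/
theorem ex_zeroOne_mem {μ : α → ℝ} (hμ : ∀ x, 0 ≤ μ x) (hμ1 : ∑ x, μ x = 1) {c : α → ℝ}
    (hc : ∀ x, c x = 0 ∨ c x = 1) : 0 ≤ ex μ c ∧ ex μ c ≤ 1 := by
  refine ⟨ex_nonneg hμ fun x => (zeroOne_bounds hc x).1, ?_⟩
  calc ex μ c ≤ ex μ (fun _ => (1 : ℝ)) := ex_mono hμ fun x => (zeroOne_bounds hc x).2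
    _ = 1 := ex_const hμ1 1

/-- **FCL, order 3, one slot.**  `E₃(a,b,d) ≥ 0` and `E₂(b,d) ≥ 0` ⇒ `E₃(a ⊔ c, b, d) ≥ 0` for an independent `{0,1}`-valued `c`.
[this work] -/
theorem sahiE3_freshCoin_nonneg_slot0 (μ : α → ℝ) (hμ : ∀ x, 0 ≤ μ x) (hμ1 : ∑ x, μ x = 1) (a b d c : α → ℝ)
    (hc : ∀ x, c x = 0 ∨ c x = 1)
    (hind : ∀ s : Finset (Fin 3), ex μ (c * ∏ i ∈ s, ![a, b, d] i) = ex μ c * ex μ (∏ i ∈ s, ![a, b, d] i))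
    (hE3 : 0 ≤ sahiE μ 3 ![a, b, d]) (hE2 : 0 ≤ sahiE μ 2 ![b, d]) :
    0 ≤ sahiE μ 3 ![a + c - a * c, b, d] := by
  rw [sahiE3_or_slot0 μ a b d c hind]
  have hp := ex_zeroOne_mem hμ hμ1 hc
  exact add_nonneg (mul_nonneg (by linarith [hp.2]) hE3) (mul_nonneg hp.1 hE2)

/-- **FCL, order 3, two slots.**  `E₃(a,b,d) ≥ 0` ⇒ `E₃(a ⊔ c, b ⊔ c, d) ≥ 0` for an independent `{0,1}`-valued `c`
(no covariance hypothesis is needed). [this work] -/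
theorem sahiE3_freshCoin_nonneg_slots01 (μ : α → ℝ) (hμ : ∀ x, 0 ≤ μ x) (hμ1 : ∑ x, μ x = 1) (a b d c : α → ℝ)
    (ha : ∀ x, a x = 0 ∨ a x = 1) (hb : ∀ x, b x = 0 ∨ b x = 1) (hd : ∀ x, d x = 0 ∨ d x = 1)
    (hc : ∀ x, c x = 0 ∨ c x = 1)
    (hind : ∀ s : Finset (Fin 3), ex μ (c * ∏ i ∈ s, ![a, b, d] i) = ex μ c * ex μ (∏ i ∈ s, ![a, b, d] i))
    (hE3 : 0 ≤ sahiE μ 3 ![a, b, d]) :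
    0 ≤ sahiE μ 3 ![a + c - a * c, b + c - b * c, d] := by
  rw [sahiE3_or_slots01 μ a b d c (zeroOne_mul_self hc) hind]
  have hp := ex_zeroOne_mem hμ hμ1 hc
  have hF := F_nonneg_of_sahiE3_nonneg μ hμ hμ1 a b d ha hb hd hE3
  have h1 : 0 ≤ (1 - ex μ c) ^ 2 * sahiE μ 3 ![a, b, d] := mul_nonneg (sq_nonneg _) hE3
  have h2 : 0 ≤ ex μ c * (1 - ex μ c) := mul_nonneg hp.1 (by linarith [hp.2])
  exact add_nonneg h1 (mul_nonneg h2 hF)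

/-! ### THREE slots (gen 14's identity) -/
/-- **Three slots (identity)** for idempotent independent `c`, `ā = 1 − a`, `p = E c`:
`E₃(a⊔c,b⊔c,d⊔c) = (1−p)·[(1−p)E₃ + p·(E(āb̄)+E(ād̄)+E(b̄d̄) − 2E(āb̄d̄)) + p(1−p)·E(ā)E(b̄)E(d̄)]`. [this work; gen 14 §3] -/
theorem sahiE3_or_slots012 (μ : α → ℝ) (hμ1 : ∑ x, μ x = 1) (a b d c : α → ℝ) (hc : ∀ x, c x * c x = c x)
    (hind : ∀ s : Finset (Fin 3), ex μ (c * ∏ i ∈ s, ![a, b, d] i) = ex μ c * ex μ (∏ i ∈ s, ![a, b, d] i)) :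
    sahiE μ 3 ![a + c - a * c, b + c - b * c, d + c - d * c] =
      (1 - ex μ c) *
        ((1 - ex μ c) * sahiE μ 3 ![a, b, d] +
          ex μ c * (ex μ ((1 - a) * (1 - b)) + ex μ ((1 - a) * (1 - d)) + ex μ ((1 - b) * (1 - d)) -
              2 * ex μ ((1 - a) * (1 - b) * (1 - d))) +
          ex μ c * (1 - ex μ c) * (ex μ (1 - a) * ex μ (1 - b) * ex μ (1 - d))) := by
  obtain ⟨ha, hb, hd, hab, had, hbd, habd⟩ := indep_unpack3 μ a b d c hind
  rw [sahiE_three, sahiE_three]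
  have one : ex μ (1 : α → ℝ) = 1 := ex_one hμ1
  -- moments of the pushed slot functions
  have e1 : ex μ (a + c - a * c) = ex μ a + ex μ c - ex μ c * ex μ a := by
    have : a + c - a * c = a + c - c * a := by funext x; simp only [Pi.mul_apply, Pi.add_apply, Pi.sub_apply]; ring
    rw [this, ex_sub, ex_add, ha]
  have e1b : ex μ (b + c - b * c) = ex μ b + ex μ c - ex μ c * ex μ b := by
    have : b + c - b * c = b + c - c * b := by funext x; simp only [Pi.mul_apply, Pi.add_apply, Pi.sub_apply]; ring
    rw [this, ex_sub, ex_add, hb]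
  have e1d : ex μ (d + c - d * c) = ex μ d + ex μ c - ex μ c * ex μ d := by
    have : d + c - d * c = d + c - c * d := by funext x; simp only [Pi.mul_apply, Pi.add_apply, Pi.sub_apply]; ring
    rw [this, ex_sub, ex_add, hd]
  have e2 : ex μ ((a + c - a * c) * (b + c - b * c) * (d + c - d * c)) =
      ex μ (a * b * d) + ex μ c - ex μ c * ex μ (a * b * d) := by
    have : (a + c - a * c) * (b + c - b * c) * (d + c - d * c) = a * b * d + c - c * (a * b * d) := by
      funext x; simp only [Pi.mul_apply, Pi.add_apply, Pi.sub_apply]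
      linear_combination ((1 - a x) * (1 - b x) * d x + (1 - a x) * b x * (1 - d x) + a x * (1 - b x) * (1 - d x)
        + (c x + 1) * (1 - a x) * (1 - b x) * (1 - d x)) * hc x
    rw [this, ex_sub, ex_add, habd]
  have e3ab : ex μ ((a + c - a * c) * (b + c - b * c)) = ex μ (a * b) + ex μ c - ex μ c * ex μ (a * b) := by
    have : (a + c - a * c) * (b + c - b * c) = a * b + c - c * (a * b) := by
      funext x; simp only [Pi.mul_apply, Pi.add_apply, Pi.sub_apply]
      linear_combination (1 - a x) * (1 - b x) * hc x
    rw [this, ex_sub, ex_add, hab]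
  have e3ad : ex μ ((a + c - a * c) * (d + c - d * c)) = ex μ (a * d) + ex μ c - ex μ c * ex μ (a * d) := by
    have : (a + c - a * c) * (d + c - d * c) = a * d + c - c * (a * d) := by
      funext x; simp only [Pi.mul_apply, Pi.add_apply, Pi.sub_apply]
      linear_combination (1 - a x) * (1 - d x) * hc x
    rw [this, ex_sub, ex_add, had]
  have e3bd : ex μ ((b + c - b * c) * (d + c - d * c)) = ex μ (b * d) + ex μ c - ex μ c * ex μ (b * d) := by
    have : (b + c - b * c) * (d + c - d * c) = b * d + c - c * (b * d) := by
      funext x; simp only [Pi.mul_apply, Pi.add_apply, Pi.sub_apply]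
      linear_combination (1 - b x) * (1 - d x) * hc x
    rw [this, ex_sub, ex_add, hbd]
  -- co-moments
  have f1 : ex μ (1 - a) = 1 - ex μ a := by rw [ex_sub, one]
  have f2 : ex μ (1 - b) = 1 - ex μ b := by rw [ex_sub, one]
  have f3 : ex μ (1 - d) = 1 - ex μ d := by rw [ex_sub, one]
  have g12 : ex μ ((1 - a) * (1 - b)) = 1 - ex μ a - ex μ b + ex μ (a * b) := by
    have : (1 - a) * (1 - b) = 1 - a - b + a * b := by funext x; simp only [Pi.mul_apply, Pi.add_apply, Pi.sub_apply, Pi.one_apply]; ring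
    rw [this, ex_add, ex_sub, ex_sub, one]
  have g13 : ex μ ((1 - a) * (1 - d)) = 1 - ex μ a - ex μ d + ex μ (a * d) := by
    have : (1 - a) * (1 - d) = 1 - a - d + a * d := by funext x; simp only [Pi.mul_apply, Pi.add_apply, Pi.sub_apply, Pi.one_apply]; ring
    rw [this, ex_add, ex_sub, ex_sub, one]
  have g23 : ex μ ((1 - b) * (1 - d)) = 1 - ex μ b - ex μ d + ex μ (b * d) := by
    have : (1 - b) * (1 - d) = 1 - b - d + b * d := by funext x; simp only [Pi.mul_apply, Pi.add_apply, Pi.sub_apply, Pi.one_apply]; ring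
    rw [this, ex_add, ex_sub, ex_sub, one]
  have g123 : ex μ ((1 - a) * (1 - b) * (1 - d)) =
      1 - ex μ a - ex μ b - ex μ d + ex μ (a * b) + ex μ (a * d) + ex μ (b * d) - ex μ (a * b * d) := by
    have : (1 - a) * (1 - b) * (1 - d) = 1 - a - b - d + a * b + a * d + b * d - a * b * d := by
      funext x; simp only [Pi.mul_apply, Pi.add_apply, Pi.sub_apply, Pi.one_apply]; ring
    rw [this, ex_sub, ex_add, ex_add, ex_add, ex_sub, ex_sub, ex_sub, one]
  rw [e1, e1b, e1d, e2, e3ab, e3ad, e3bd, f1, f2, f3, g12, g13, g23, g123]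
  ring

/-- **FCL, order 3, three slots.**  `E₃(a,b,d) ≥ 0` ⇒ `E₃(a ⊔ c, b ⊔ c, d ⊔ c) ≥ 0` for an independent `{0,1}`-valued `c`. [this work] -/
theorem sahiE3_freshCoin_nonneg_slots012 (μ : α → ℝ) (hμ : ∀ x, 0 ≤ μ x) (hμ1 : ∑ x, μ x = 1) (a b d c : α → ℝ)
    (ha : ∀ x, a x = 0 ∨ a x = 1) (hb : ∀ x, b x = 0 ∨ b x = 1) (hd : ∀ x, d x = 0 ∨ d x = 1)
    (hc : ∀ x, c x = 0 ∨ c x = 1)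
    (hind : ∀ s : Finset (Fin 3), ex μ (c * ∏ i ∈ s, ![a, b, d] i) = ex μ c * ex μ (∏ i ∈ s, ![a, b, d] i))
    (hE3 : 0 ≤ sahiE μ 3 ![a, b, d]) :
    0 ≤ sahiE μ 3 ![a + c - a * c, b + c - b * c, d + c - d * c] := by
  rw [sahiE3_or_slots012 μ hμ1 a b d c (zeroOne_mul_self hc) hind]
  have hp := ex_zeroOne_mem hμ hμ1 hc
  have h01a := fun x => zeroOne_bounds ha x
  have h01b := fun x => zeroOne_bounds hb x
  have h01d := fun x => zeroOne_bounds hd x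
  -- X ≥ 0 : pointwise, (1−a)(1−b) + (1−a)(1−d) + (1−b)(1−d) − 2(1−a)(1−b)(1−d) ≥ 0 for 0/1 values
  have hX : 0 ≤ ex μ ((1 - a) * (1 - b)) + ex μ ((1 - a) * (1 - d)) + ex μ ((1 - b) * (1 - d)) -
      2 * ex μ ((1 - a) * (1 - b) * (1 - d)) := by
    have : ex μ ((1 - a) * (1 - b)) + ex μ ((1 - a) * (1 - d)) + ex μ ((1 - b) * (1 - d)) -
        2 * ex μ ((1 - a) * (1 - b) * (1 - d)) =
        ex μ ((1 - a) * (1 - b) + (1 - a) * (1 - d) + (1 - b) * (1 - d) - (2 : ℝ) • ((1 - a) * (1 - b) * (1 - d))) := by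
      rw [ex_sub, ex_add, ex_add, ex_smul]
    rw [this]
    refine ex_nonneg hμ fun x => ?_
    simp only [Pi.sub_apply, Pi.add_apply, Pi.mul_apply, Pi.one_apply, Pi.smul_apply, smul_eq_mul]
    rcases ha x with h1 | h1 <;> rcases hb x with h2 | h2 <;> rcases hd x with h3 | h3 <;>
      simp only [h1, h2, h3] <;> norm_num
  have hY : 0 ≤ ex μ (1 - a) * ex μ (1 - b) * ex μ (1 - d) := by
    refine mul_nonneg (mul_nonneg ?_ ?_) ?_
    · exact ex_nonneg hμ fun x => by simp only [Pi.sub_apply, Pi.one_apply]; linarith [(h01a x).2]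
    · exact ex_nonneg hμ fun x => by simp only [Pi.sub_apply, Pi.one_apply]; linarith [(h01b x).2]
    · exact ex_nonneg hμ fun x => by simp only [Pi.sub_apply, Pi.one_apply]; linarith [(h01d x).2]
  have hq : 0 ≤ 1 - ex μ c := by linarith [hp.2]
  refine mul_nonneg hq (add_nonneg (add_nonneg (mul_nonneg hq hE3) (mul_nonneg hp.1 hX)) ?_)
  exact mul_nonneg (mul_nonneg hp.1 hq) hY

end SahiFreshCoinOrderThree
end Summit.CriticalPhenomena.PercolationContinuityZ3.Theorems
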